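import Summits.RiemannHypothesis.RiemannHypothesis.Theorems.TwoPrimeFoldRigidity.Negative.MBTLevels

/-!
# One-lattice moment-blind towers, part 3: phases and the exact level solve

HONEST LABEL.  Negative-side helper toward `¬ IntegerScrew.TwoPrimeFoldRigidity` (item stmt-RiemannHypothesis-25784);
record-negative programme; 0 toward RH.  RH is not proved, not used, not mentioned below.
Nothing here bears on the truth of RH.

Own-time phases of the eleven gons (`(-1)^N`, `(-1)^N i`, `1`), the triangular shift structure of the moments along a
quintuple, positivity of the solved amplitudes (`f_le_solve`) and exactness (`solve_exact`: the level reproduces the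
target moments `r = 0,1,2`; the binomial shift `(1,4,6,4,1)` changes no moment).
-/

set_option linter.dupNamespace false

noncomputable section

open scoped ComplexConjugate
open Complex Finset

namespace Summit.RiemannHypothesis.RiemannHypothesis.Theorems.TwoPrimeFoldRigidity.Negative.MBT

namespace Prm

variable (p : Prm)

/-! ## §3 Lattice phases of a level -/

/-- `e^{iπ/2} = i`. -/
theorem exp_pi_div_two_mul_I : Complex.exp (((Real.pi / 2 : ℝ) : ℂ) * I) = I := by
  rw [Complex.exp_mul_I]
  have h1 : Complex.cos ((Real.pi / 2 : ℝ) : ℂ) = 0 := by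
    rw [show (((Real.pi / 2 : ℝ)) : ℂ) = (Real.pi : ℂ) / 2 by push_cast; ring]; exact Complex.cos_pi_div_two
  have h2 : Complex.sin ((Real.pi / 2 : ℝ) : ℂ) = 1 := by
    rw [show (((Real.pi / 2 : ℝ)) : ℂ) = (Real.pi : ℂ) / 2 by push_cast; ring]; exact Complex.sin_pi_div_two
  rw [h1, h2]; ring

/-- at the `j'`-th multiple of its order, gon `g` of level `m` has base phase
`e^{(σ + iγ) t} = e^{σ t} i^{Q j'}`. -/
theorem exp_base_mul (m : ℕ) (g : G) (j' : ℕ) :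
    Complex.exp ((((p.σ m : ℝ) : ℂ) + ((p.γ m g : ℝ) : ℂ) * I) * ((((j' * p.nn m : ℕ) : ℝ) * p.h : ℝ) : ℂ)) =
      ((Real.exp (p.σ m * (((j' * p.nn m : ℕ) : ℝ) * p.h)) : ℝ) : ℂ) * I ^ (p.Qn m g * j') := by
  rw [add_mul, Complex.exp_add, Complex.ofReal_exp]
  have hn' : ((p.nn m : ℕ) : ℂ) ≠ 0 := by exact_mod_cast p.nn_ne_zero m
  have hh' : ((p.h : ℝ) : ℂ) ≠ 0 := by exact_mod_cast p.hh.ne'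
  have e1 : ((p.σ m : ℝ) : ℂ) * ((((j' * p.nn m : ℕ) : ℝ) * p.h : ℝ) : ℂ) =
      ((p.σ m * (((j' * p.nn m : ℕ) : ℝ) * p.h) : ℝ) : ℂ) := by push_cast; ring
  have e2 : ((p.γ m g : ℝ) : ℂ) * I * ((((j' * p.nn m : ℕ) : ℝ) * p.h : ℝ) : ℂ) =
      ((p.Qn m g * j' : ℕ) : ℂ) * ((((Real.pi / 2 : ℝ)) : ℂ) * I) := by
    simp only [γ]; push_cast; field_simp
  rw [e1, e2, Complex.exp_nat_mul, exp_pi_div_two_mul_I]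

/-- `i^{4a} = 1`. -/
theorem I_pow_four_mul (a : ℕ) : I ^ (4 * a) = 1 := by
  rw [pow_mul, show (I : ℂ) ^ 4 = 1 from Complex.I_pow_four, one_pow]

/-- `i^{2a} = (-1)^a`. -/
theorem I_pow_two_mul (a : ℕ) : I ^ (2 * a) = (-1) ^ a := by
  rw [pow_mul, Complex.I_sq]

/-- own-time phase of the real quintuple: `(-1)^N`. -/
theorem φ_inl (m : ℕ) (N : Fin 5) : p.φ m (Sum.inl N) = (-1) ^ (N : ℕ) := by
  simp only [φ, Qn]
  have e : 4 * p.nn m ^ 2 * p.P₀ + 2 * (N : ℕ) * (2 * p.nn m ^ 2 * p.P₀ + 1) =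
      4 * (p.nn m ^ 2 * p.P₀ + (N : ℕ) * (p.nn m ^ 2 * p.P₀)) + 2 * (N : ℕ) := by ring
  rw [e, pow_add, I_pow_four_mul, I_pow_two_mul, one_mul]

/-- own-time phase of the imaginary quintuple: `(-1)^N i`. -/
theorem φ_inr_inl (m : ℕ) (N : Fin 5) : p.φ m (Sum.inr (Sum.inl N)) = (-1) ^ (N : ℕ) * I := by
  simp only [φ, Qn]
  have e : 4 * p.nn m ^ 2 * p.P₀ + 2 * (N : ℕ) * (2 * p.nn m ^ 2 * p.P₀ + 1) + 1 =
      4 * (p.nn m ^ 2 * p.P₀ + (N : ℕ) * (p.nn m ^ 2 * p.P₀)) + 2 * (N : ℕ) + 1 := by ring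
  rw [e, pow_add, pow_add, I_pow_four_mul, I_pow_two_mul, one_mul, pow_one]

/-- own-time phase of the forcing gon: `1`. -/
theorem φ_inr_inr (m : ℕ) (u : Unit) : p.φ m (Sum.inr (Sum.inr u)) = 1 := by
  simp only [φ, Qn]
  have e : 4 * p.nn m ^ 2 * p.P₀ + 12 * (2 * p.nn m ^ 2 * p.P₀ + 1) =
      4 * (p.nn m ^ 2 * p.P₀ + 3 * (2 * p.nn m ^ 2 * p.P₀ + 1)) := by ring
  rw [e, I_pow_four_mul]

/-- the first own multiple shows the own-time phase. -/
theorem φ_one (m : ℕ) (g : G) : I ^ (p.Qn m g * 1) = p.φ m g := by rw [mul_one]; rfl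

/-- phases are unimodular. -/
theorem norm_φ_pow (m : ℕ) (g : G) (j' : ℕ) : ‖I ^ (p.Qn m g * j')‖ = 1 := by
  rw [norm_pow, Complex.norm_I, one_pow]

/-! ## §3b Moments of the gons of one level (shift structure) -/

/-- zeroth moments of the level gons are `1`. -/
theorem W_zero (m : ℕ) (g : G) : p.W m g 0 = 1 := Wm_zero (p.nn_ne_zero m) _ _ _

/-- first moments along the real quintuple (shift structure). -/
theorem W_inl_one (m : ℕ) (N : Fin 5) :
    p.W m (Sum.inl N) 1 = p.W m (Sum.inl 0) 1 - (((N : ℕ) : ℝ) * p.η m : ℝ) * I := by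
  simp only [W]; rw [p.γ_inl m N, Wm_one_shift (p.nn_ne_zero m)]

/-- second moments along the real quintuple (shift structure). -/
theorem W_inl_two (m : ℕ) (N : Fin 5) :
    p.W m (Sum.inl N) 2 = p.W m (Sum.inl 0) 2 - 2 * ((((N : ℕ) : ℝ) * p.η m : ℝ) * I) * p.W m (Sum.inl 0) 1
      - ((((N : ℕ) : ℝ) * p.η m : ℝ) : ℂ) ^ 2 := by
  simp only [W]; rw [p.γ_inl m N, Wm_two_shift (p.nn_ne_zero m)]

/-- first moments along the imaginary quintuple (shift structure). -/
theorem W_inr_one (m : ℕ) (N : Fin 5) :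
    p.W m (Sum.inr (Sum.inl N)) 1 = p.W m (Sum.inr (Sum.inl 0)) 1 - (((N : ℕ) : ℝ) * p.η m : ℝ) * I := by
  simp only [W]; rw [p.γ_inr_inl m N, Wm_one_shift (p.nn_ne_zero m)]

/-- second moments along the imaginary quintuple (shift structure). -/
theorem W_inr_two (m : ℕ) (N : Fin 5) :
    p.W m (Sum.inr (Sum.inl N)) 2 = p.W m (Sum.inr (Sum.inl 0)) 2
      - 2 * ((((N : ℕ) : ℝ) * p.η m : ℝ) * I) * p.W m (Sum.inr (Sum.inl 0)) 1
      - ((((N : ℕ) : ℝ) * p.η m : ℝ) : ℂ) ^ 2 := by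
  simp only [W]; rw [p.γ_inr_inl m N, Wm_two_shift (p.nn_ne_zero m)]

/-! ## §4 The level solve: six real unknowns on two phase-conjugate quintuples, positivity by a null shift -/

/-- `f_m > 0`. -/
theorem f_pos (m : ℕ) : 0 < f m := by unfold f; positivity

section Solve

variable (m : ℕ) (τ : ℕ → ℂ)

/-- the entries of the binomial row. -/
theorem bin4_vals : bin4 0 = 1 ∧ bin4 1 = 4 ∧ bin4 2 = 6 ∧ bin4 3 = 4 ∧ bin4 4 = 1 := by
  simp [bin4]

/-- binomial entries are `≥ 1`. -/
theorem one_le_bin4 (N : Fin 5) : 1 ≤ bin4 N := by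
  fin_cases N <;> simp [bin4]

/-- binomial entries are `≤ 6`. -/
theorem bin4_le (N : Fin 5) : bin4 N ≤ 6 := by
  fin_cases N <;> simp [bin4] <;> norm_num

/-- entries of the raw real coefficients. -/
theorem cR_vals : p.cR m τ 0 = a1 τ + p.a2 m τ + p.a3 m τ ∧ p.cR m τ 1 = p.a2 m τ + 2 * p.a3 m τ ∧
    p.cR m τ 2 = p.a3 m τ ∧ p.cR m τ 3 = 0 ∧ p.cR m τ 4 = 0 := by
  simp [cR]

/-- entries of the raw imaginary coefficients. -/
theorem cI_vals : p.cI m τ 0 = a4 τ + p.a5 m τ + p.a6 m τ ∧ p.cI m τ 1 = p.a5 m τ + 2 * p.a6 m τ ∧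
    p.cI m τ 2 = p.a6 m τ ∧ p.cI m τ 3 = 0 ∧ p.cI m τ 4 = 0 := by
  simp [cI]

/-- each raw real coefficient is bounded by their `ℓ¹` size. -/
theorem abs_cR_le (N : Fin 5) : |p.cR m τ N| ≤ p.SR m τ := by
  have h := p.cR_vals m τ
  simp only [SR]
  fin_cases N
  · simp only [Fin.zero_eta, Fin.isValue]; linarith [abs_nonneg (p.cR m τ 1), abs_nonneg (p.cR m τ 2)]
  · simp only [Fin.mk_one, Fin.isValue]; linarith [abs_nonneg (p.cR m τ 0), abs_nonneg (p.cR m τ 2)]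
  · simp only [Fin.reduceFinMk, Fin.isValue]; linarith [abs_nonneg (p.cR m τ 0), abs_nonneg (p.cR m τ 1)]
  · simp only [Fin.reduceFinMk, Fin.isValue, h.2.2.2.1, abs_zero]
    linarith [abs_nonneg (p.cR m τ 0), abs_nonneg (p.cR m τ 1), abs_nonneg (p.cR m τ 2)]
  · simp only [Fin.reduceFinMk, Fin.isValue, h.2.2.2.2, abs_zero]
    linarith [abs_nonneg (p.cR m τ 0), abs_nonneg (p.cR m τ 1), abs_nonneg (p.cR m τ 2)]

/-- each raw imaginary coefficient is bounded by their `ℓ¹` size. -/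
theorem abs_cI_le (N : Fin 5) : |p.cI m τ N| ≤ p.SI m τ := by
  have h := p.cI_vals m τ
  simp only [SI]
  fin_cases N
  · simp only [Fin.zero_eta, Fin.isValue]; linarith [abs_nonneg (p.cI m τ 1), abs_nonneg (p.cI m τ 2)]
  · simp only [Fin.mk_one, Fin.isValue]; linarith [abs_nonneg (p.cI m τ 0), abs_nonneg (p.cI m τ 2)]
  · simp only [Fin.reduceFinMk, Fin.isValue]; linarith [abs_nonneg (p.cI m τ 0), abs_nonneg (p.cI m τ 1)]
  · simp only [Fin.reduceFinMk, Fin.isValue, h.2.2.2.1, abs_zero]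
    linarith [abs_nonneg (p.cI m τ 0), abs_nonneg (p.cI m τ 1), abs_nonneg (p.cI m τ 2)]
  · simp only [Fin.reduceFinMk, Fin.isValue, h.2.2.2.2, abs_zero]
    linarith [abs_nonneg (p.cI m τ 0), abs_nonneg (p.cI m τ 1), abs_nonneg (p.cI m τ 2)]

/-- every amplitude is at least the slack `f_m > 0`. -/
theorem f_le_solve (g : G) : f m ≤ p.solve m τ g := by
  have hf := (f_pos m).le
  rcases g with N | N | u
  · simp only [solve]
    have h1 := p.abs_cR_le m τ N; have h2 := one_le_bin4 N
    have h3 : -p.cR m τ N ≤ |p.cR m τ N| := neg_le_abs _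
    have hS : 0 ≤ p.SR m τ := le_trans (abs_nonneg _) h1
    nlinarith
  · simp only [solve]
    have h1 := p.abs_cI_le m τ N; have h2 := one_le_bin4 N
    have h3 : -p.cI m τ N ≤ |p.cI m τ N| := neg_le_abs _
    have hS : 0 ≤ p.SI m τ := le_trans (abs_nonneg _) h1
    nlinarith
  · simp only [solve]; exact le_rfl

/-- every amplitude of the level solve is positive. -/
theorem solve_pos (g : G) : 0 < p.solve m τ g := lt_of_lt_of_le (f_pos m) (p.f_le_solve m τ g)

/-- total amplitude of the level is controlled by the raw sizes: `Σ_g solve ≤ 17 (S_R + S_I) + 33 f`. -/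
theorem sum_solve_le : ∑ g : G, p.solve m τ g ≤ 17 * (p.SR m τ + p.SI m τ) + 33 * f m := by
  simp only [Fintype.sum_sum_type, Fintype.sum_unique, Fin.sum_univ_five]
  simp only [solve]
  have hb := bin4_vals
  have hR := p.cR_vals m τ; have hI := p.cI_vals m τ
  have e0 := le_abs_self (p.cR m τ 0); have e1 := le_abs_self (p.cR m τ 1); have e2 := le_abs_self (p.cR m τ 2)
  have g0 := le_abs_self (p.cI m τ 0); have g1 := le_abs_self (p.cI m τ 1); have g2 := le_abs_self (p.cI m τ 2)
  simp only [SR, SI] at *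
  rw [hb.1, hb.2.1, hb.2.2.1, hb.2.2.2.1, hb.2.2.2.2, hR.2.2.2.1, hR.2.2.2.2, hI.2.2.2.1, hI.2.2.2.2]
  nlinarith [f_pos m, abs_nonneg (p.cR m τ 0), abs_nonneg (p.cR m τ 1), abs_nonneg (p.cR m τ 2),
    abs_nonneg (p.cI m τ 0), abs_nonneg (p.cI m τ 1), abs_nonneg (p.cI m τ 2)]

/-- values of the numerals of `Fin 5`. -/
theorem fin5_vals : ((0 : Fin 5) : ℕ) = 0 ∧ ((1 : Fin 5) : ℕ) = 1 ∧ ((2 : Fin 5) : ℕ) = 2 ∧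
    ((3 : Fin 5) : ℕ) = 3 ∧ ((4 : Fin 5) : ℕ) = 4 := by
  refine ⟨rfl, rfl, rfl, rfl, rfl⟩

/-- **exactness of the level solve**: for `r = 0, 1, 2` the eleven gons reproduce the target moments,
`Σ_g solve_g · φ_g · W_r(g) = τ_r + f · W_r(forcing gon)`. -/
theorem solve_exact (r : ℕ) (hr : r ≤ 2) :
    ∑ g : G, (p.solve m τ g : ℂ) * p.φ m g * p.W m g r = τ r + (f m : ℂ) * p.W m (Sum.inr (Sum.inr ())) r := by
  have hη : (p.η m : ℂ) ≠ 0 := by exact_mod_cast (p.η_pos m).ne'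
  have hb := bin4_vals; have hR := p.cR_vals m τ; have hI := p.cI_vals m τ; have h5 := fin5_vals
  simp only [Fintype.sum_sum_type, Fintype.sum_unique, Fin.sum_univ_five, PUnit.default_eq_unit]
  simp only [solve, φ_inl, φ_inr_inl, φ_inr_inr]
  rw [hb.1, hb.2.1, hb.2.2.1, hb.2.2.2.1, hb.2.2.2.2, hR.1, hR.2.1, hR.2.2.1, hR.2.2.2.1, hR.2.2.2.2,
    hI.1, hI.2.1, hI.2.2.1, hI.2.2.2.1, hI.2.2.2.2, h5.1, h5.2.1, h5.2.2.1, h5.2.2.2.1, h5.2.2.2.2]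
  interval_cases r
  · -- moment 0
    simp only [W_zero]
    have key : ((a1 τ : ℝ) : ℂ) + ((a4 τ : ℝ) : ℂ) * I = τ 0 := by
      simp only [a1, a4]; exact Complex.re_add_im (τ 0)
    push_cast
    linear_combination key
  · -- moment 1
    rw [p.W_inl_one m 1, p.W_inl_one m 2, p.W_inl_one m 3, p.W_inl_one m 4,
      p.W_inr_one m 1, p.W_inr_one m 2, p.W_inr_one m 3, p.W_inr_one m 4,
      h5.2.1, h5.2.2.1, h5.2.2.2.1, h5.2.2.2.2]
    have h2 : ((p.a2 m τ : ℝ) : ℂ) * (p.η m : ℂ) = (((p.r1 m τ).im : ℝ) : ℂ) := by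
      simp only [a2]; push_cast; field_simp
    have h5' : ((p.a5 m τ : ℝ) : ℂ) * (p.η m : ℂ) = -(((p.r1 m τ).re : ℝ) : ℂ) := by
      simp only [a5]; push_cast; field_simp
    have h0 := Complex.re_add_im (p.r1 m τ)
    have hr1 : p.r1 m τ = τ 1 - (a1 τ : ℂ) * p.W m (Sum.inl 0) 1 - (a4 τ : ℂ) * I * p.W m (Sum.inr (Sum.inl 0)) 1 :=
      rfl
    have key : ((p.a2 m τ : ℝ) : ℂ) * (p.η m : ℂ) * I - ((p.a5 m τ : ℝ) : ℂ) * (p.η m : ℂ) =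
        τ 1 - (a1 τ : ℂ) * p.W m (Sum.inl 0) 1 - (a4 τ : ℂ) * I * p.W m (Sum.inr (Sum.inl 0)) 1 := by
      rw [h2, h5', ← hr1]; linear_combination h0
    push_cast
    linear_combination key + ((p.a5 m τ : ℝ) : ℂ) * (p.η m : ℂ) * Complex.I_sq
  · -- moment 2
    rw [p.W_inl_two m 1, p.W_inl_two m 2, p.W_inl_two m 3, p.W_inl_two m 4,
      p.W_inr_two m 1, p.W_inr_two m 2, p.W_inr_two m 3, p.W_inr_two m 4,
      h5.2.1, h5.2.2.1, h5.2.2.2.1, h5.2.2.2.2]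
    have h3 : ((p.a3 m τ : ℝ) : ℂ) * (-2 * (p.η m : ℂ) ^ 2) = (((p.r2 m τ).re : ℝ) : ℂ) := by
      simp only [a3]; push_cast; field_simp
    have h6 : ((p.a6 m τ : ℝ) : ℂ) * (-2 * (p.η m : ℂ) ^ 2) = (((p.r2 m τ).im : ℝ) : ℂ) := by
      simp only [a6]; push_cast; field_simp
    have h0 := Complex.re_add_im (p.r2 m τ)
    have hr2 : p.r2 m τ = τ 2 - (a1 τ : ℂ) * p.W m (Sum.inl 0) 2 - (a4 τ : ℂ) * I * p.W m (Sum.inr (Sum.inl 0)) 2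
        - (p.a2 m τ : ℂ) * (2 * I * (p.η m : ℂ) * p.W m (Sum.inl 0) 1 + (p.η m : ℂ) ^ 2)
        - (p.a5 m τ : ℂ) * (-2 * (p.η m : ℂ) * p.W m (Sum.inr (Sum.inl 0)) 1 + I * (p.η m : ℂ) ^ 2) := rfl
    have key : ((p.a3 m τ : ℝ) : ℂ) * (-2 * (p.η m : ℂ) ^ 2) + ((p.a6 m τ : ℝ) : ℂ) * (-2 * (p.η m : ℂ) ^ 2) * I =
        τ 2 - (a1 τ : ℂ) * p.W m (Sum.inl 0) 2 - (a4 τ : ℂ) * I * p.W m (Sum.inr (Sum.inl 0)) 2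
        - (p.a2 m τ : ℂ) * (2 * I * (p.η m : ℂ) * p.W m (Sum.inl 0) 1 + (p.η m : ℂ) ^ 2)
        - (p.a5 m τ : ℂ) * (-2 * (p.η m : ℂ) * p.W m (Sum.inr (Sum.inl 0)) 1 + I * (p.η m : ℂ) ^ 2) := by
      rw [h3, h6, ← hr2]; linear_combination h0
    push_cast
    linear_combination key + 2 * ((p.a5 m τ : ℝ) : ℂ) * (p.η m : ℂ) * p.W m (Sum.inr (Sum.inl 0)) 1 * Complex.I_sq

end Solve

end Prm

end Summit.RiemannHypothesis.RiemannHypothesis.Theorems.TwoPrimeFoldRigidity.Negative.MBT
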